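import Summits.BirchSwinnertonDyer.BirchSwinnertonDyer.Theorems.Rank2Observatory2DescSignature
import Summits.BirchSwinnertonDyer.BirchSwinnertonDyer.Theorems.Rank2Observatory2DescNormPrime
import Literature.NumberTheory.NumberFields.CubicFieldIntegers
import Mathlib.NumberTheory.NumberField.ClassNumber
import Mathlib.Analysis.Real.Pi.Bounds
import HarnessLib

/-!
# BirchSwinnertonDyer — rank ≥ 2 observatory: class-number-one certificates for cubic fields with `|Δ| ≤ 199`

HONEST FRAMING: per-curve certified theorems and census instruments; no claim on BSD in rank ≥ 2.

Generic file of the KERNEL-2DESC instrument (design `b2b-bsdr2-cert-3/KERNEL-2DESC.md` §8 S7, §9d).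
The general 2-descent over the cubic `2`-division field `K = ℚ(θ)` needs `𝓞 K` to be a PID
(`mordellWeilRank_le_of_coverSet`). For `|Δ| ≤ 49` this is the bare Minkowski bound
(`isPrincipalIdealRing_of_abs_disc_le`); this file extends the reach to `|Δ(F)| ≤ 199` by a
CERTIFICATE: the Minkowski constant of a cubic field is `M_K = (4/π)^{r₂} (3!/3³) √|d_K| < 4` as soon as
`|d_K| ≤ |Δ(F)| ≤ 199`, so every ideal class contains an ideal of norm `≤ 3`, and it suffices that every
prime ideal of norm `2` or `3` is principal. A prime ideal of prime norm `p` is the kernel of a ring map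
`ψ : 𝓞 K → ℤ/p` (`exists_ringHom_zmod_of_absNorm_eq`), so the certificate is: for every ring map
`ψ : 𝓞 K → ℤ/p`, `p ∈ {2, 3}`, a PRIME ELEMENT `e` with `ψ(e) = 0` (then `ker ψ = (e)`). Since `ψ(θ)` is a
root of `F mod p`, the per-field discharge is a finite case split over `ℤ/p` (`psi_cases2/3`): roots
`t` are answered by an explicit element of norm `±p` vanishing at `t`, non-roots by `decide`; a field
whose polynomial has no root mod `2` and mod `3` needs no element at all (`cert_of_no_root`).
Sorry-free; axioms `propext`, `Classical.choice`, `Quot.sound`.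
[cite: Marcus2018, Ch. 5, Cor. 2 of Thm. 37 and the discussion after Thm. 37] [cite: Marcus2018, Ch. 3, Thm. 22]
-/

-- single-conjunct summit: `Summit.BirchSwinnertonDyer.BirchSwinnertonDyer.…` repeats the name by design
set_option linter.dupNamespace false

noncomputable section

open scoped Classical NumberField Real nonZeroDivisors

open Literature.NumberTheory.NumberFields Polynomial Module NumberField NumberField.InfinitePlace Ideal Nat

namespace Summit.BirchSwinnertonDyer.BirchSwinnertonDyer.Rank2Observatory.TwoDescCubic

variable {K : Type*} [Field K] [NumberField K] {A B C : ℤ} {θ : K}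

/-- **Minkowski constant of a cubic field with `|d_K| ≤ 199` is `< 4`**:
`(4/π)^{r₂} · (3!/3³) · √|d_K| ≤ (4/π)(2/9)√199 < 4`. [cite: Marcus2018, Ch. 5, Cor. 2 of Thm. 37] -/
theorem minkowskiBound_lt_four (h3 : finrank ℚ K = 3) (hd : |discr K| ≤ 199) :
    (4 / π) ^ nrComplexPlaces K *
      ((finrank ℚ K)! / (finrank ℚ K) ^ (finrank ℚ K) * √|discr K|) < 4 := by
  have hc : nrComplexPlaces K ≤ 1 := nrComplexPlaces_le_one h3
  have h1 : (1 : ℝ) ≤ 4 / π := by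
    rw [le_div_iff₀ Real.pi_pos]; linarith [Real.pi_le_four]
  have hX : (4 / π) ^ nrComplexPlaces K ≤ 4 / π := by
    calc (4 / π) ^ nrComplexPlaces K ≤ (4 / π) ^ 1 := pow_le_pow_right₀ h1 hc
      _ = 4 / π := pow_one _
  have hX0 : (0 : ℝ) ≤ (4 / π) ^ nrComplexPlaces K := by positivity
  have hπ : 4 / π < (1.2734 : ℝ) := by
    rw [div_lt_iff₀ Real.pi_pos]; nlinarith [Real.pi_gt_d4]
  have hdR : |((discr K : ℤ) : ℝ)| ≤ 199 := by
    rw [← Int.cast_abs]; exact_mod_cast hd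
  have hZ : √|((discr K : ℤ) : ℝ)| < 14.13 := by
    rw [Real.sqrt_lt' (by norm_num)]; nlinarith [hdR]
  have hZ0 : (0 : ℝ) ≤ √|((discr K : ℤ) : ℝ)| := Real.sqrt_nonneg _
  rw [h3]
  have hY : ((3 : ℕ)! : ℝ) / ((3 : ℕ) : ℝ) ^ (3 : ℕ) = 2 / 9 := by norm_num [Nat.factorial]
  rw [hY]
  nlinarith [mul_nonneg hX0 hZ0, mul_le_mul_of_nonneg_right hX hZ0]

/-- **A prime ideal of prime norm containing a prime element that every `ψ : 𝓞 K → ℤ/p` killing the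
ideal also kills is principal** — the working form: from `absNorm I = p` get `ψ` with `I ⊆ ker ψ`
(`exists_ringHom_zmod_of_absNorm_eq`); a prime element `e ∈ ker ψ` generates a maximal ideal inside the
proper ideal `ker ψ`, so `ker ψ = (e) ⊇ I`, and `I` maximal gives `I = (e)`. [cite: Marcus2018, Ch. 3, Thm. 22] -/
theorem isPrincipal_of_absNorm_prime {I : Ideal (𝓞 K)} (hI : I.IsPrime) {p : ℕ} (hp : p.Prime)
    (hN : absNorm I = p) (hcert : ∀ ψ : 𝓞 K →+* ZMod p, ∃ e : 𝓞 K, ψ e = 0 ∧ Prime e) :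
    Submodule.IsPrincipal I := by
  haveI : Fact p.Prime := ⟨hp⟩
  obtain ⟨ψ, hψ⟩ := exists_ringHom_zmod_of_absNorm_eq hp hN
  obtain ⟨e, he0, hepr⟩ := hcert ψ
  have hI0 : I ≠ ⊥ := by
    intro h; rw [h, absNorm_bot] at hN; exact hp.ne_zero hN.symm
  have hImax : I.IsMaximal := hI.isMaximal hI0
  have hemax : (Ideal.span ({e} : Set (𝓞 K))).IsMaximal :=
    ((Ideal.span_singleton_prime hepr.ne_zero).mpr hepr).isMaximal
      (by simpa [Ideal.span_singleton_eq_bot] using hepr.ne_zero)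
  have hker : RingHom.ker ψ ≠ ⊤ := RingHom.ker_ne_top ψ
  have hle : Ideal.span ({e} : Set (𝓞 K)) ≤ RingHom.ker ψ := by
    rw [Ideal.span_le, Set.singleton_subset_iff]; exact he0
  have hk : RingHom.ker ψ = Ideal.span {e} := (hemax.eq_of_le hker hle).symm
  have hIle : I ≤ Ideal.span {e} := fun y hy => hk ▸ (RingHom.mem_ker).mpr (hψ y hy)
  exact ⟨⟨e, hImax.eq_of_le hemax.ne_top hIle⟩⟩

/-- **Class number one by certificate at `2` and `3`** for a cubic field `K = ℚ(θ)`, `F(θ) = 0`,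
`|Δ(F)| ≤ 199`: if every ring map `𝓞 K → ℤ/2` and `𝓞 K → ℤ/3` kills some prime element, `𝓞 K` is a
PID (Minkowski bound `< 4`; prime ideals of norm `2`, `3` are principal by `isPrincipal_of_absNorm_prime`).
[cite: Marcus2018, Ch. 5, Cor. 2 of Thm. 37] -/
theorem isPrincipalIdealRing_of_cert (hirr : Irreducible (MonicCubic.polyQ A B C))
    (hθ : aeval θ (MonicCubic.poly A B C) = 0) (h3 : finrank ℚ K = 3)
    (hd : |MonicCubic.disc A B C| ≤ 199)
    (h2 : ∀ ψ : 𝓞 K →+* ZMod 2, ∃ e : 𝓞 K, ψ e = 0 ∧ Prime e)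
    (h3' : ∀ ψ : 𝓞 K →+* ZMod 3, ∃ e : 𝓞 K, ψ e = 0 ∧ Prime e) :
    IsPrincipalIdealRing (𝓞 K) := by
  have hdK : |discr K| ≤ 199 := (abs_discr_le_abs_disc hirr hθ h3).trans hd
  have hM := minkowskiBound_lt_four h3 hdK
  refine RingOfIntegers.isPrincipalIdealRing_of_isPrincipal_of_norm_le_of_isPrime (fun I hI hIN => ?_)
  have hlt : (absNorm (I : Ideal (𝓞 K)) : ℝ) < 4 := lt_of_le_of_lt hIN hM
  have hle3 : absNorm (I : Ideal (𝓞 K)) ≤ 3 := by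
    have : (absNorm (I : Ideal (𝓞 K)) : ℝ) < (4 : ℕ) := by exact_mod_cast hlt
    exact Nat.lt_succ_iff.mp (by exact_mod_cast this)
  have h0 : absNorm (I : Ideal (𝓞 K)) ≠ 0 := absNorm_ne_zero_of_nonZeroDivisors I
  have h1 : absNorm (I : Ideal (𝓞 K)) ≠ 1 := fun h => hI.ne_top (absNorm_eq_one_iff.mp h)
  interval_cases hn : absNorm (I : Ideal (𝓞 K))
  · exact absurd rfl h0
  · exact absurd rfl h1
  · exact isPrincipal_of_absNorm_prime hI Nat.prime_two hn h2
  · exact isPrincipal_of_absNorm_prime hI Nat.prime_three hn h3'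

/-- The image of `θ` under any ring map `ψ : 𝓞 K → S` is a root of `F` in `S`. [folklore] -/
theorem map_thetaInt_root (hθ : aeval θ (MonicCubic.poly A B C) = 0) {S : Type*} [CommRing S]
    (ψ : 𝓞 K →+* S) :
    ψ (MonicCubic.thetaInt hθ) ^ 3 + (A : S) * ψ (MonicCubic.thetaInt hθ) ^ 2 +
      (B : S) * ψ (MonicCubic.thetaInt hθ) + (C : S) = 0 := by
  have h := congrArg ψ (MonicCubic.thetaInt_rel hθ)
  simp only [map_add, map_mul, map_pow, map_intCast, map_zero] at h
  linear_combination h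

/-- **No root, no condition**: if `F` has no root modulo `q`, there is no ring map `𝓞 K → ℤ/q` at all,
so the certificate condition at `q` holds vacuously. [folklore] -/
theorem cert_of_no_root (hθ : aeval θ (MonicCubic.poly A B C) = 0) {q : ℕ} (ψ : 𝓞 K →+* ZMod q)
    (h : ∀ t : ZMod q, t ^ 3 + (A : ZMod q) * t ^ 2 + (B : ZMod q) * t + (C : ZMod q) ≠ 0) :
    ∃ e : 𝓞 K, ψ e = 0 ∧ Prime e :=
  absurd (map_thetaInt_root hθ ψ) (h _)

/-- **Case split over the residue of `θ`**: to certify the condition at `q` it suffices to answer every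
`t : ℤ/q` with `ψ(θ) = t` and `F(t) = 0`. [folklore] -/
theorem cert_of_cases (hθ : aeval θ (MonicCubic.poly A B C) = 0) {q : ℕ} (ψ : 𝓞 K →+* ZMod q)
    (h : ∀ t : ZMod q, ψ (MonicCubic.thetaInt hθ) = t →
      t ^ 3 + (A : ZMod q) * t ^ 2 + (B : ZMod q) * t + (C : ZMod q) = 0 →
      ∃ e : 𝓞 K, ψ e = 0 ∧ Prime e) :
    ∃ e : 𝓞 K, ψ e = 0 ∧ Prime e :=
  h _ rfl (map_thetaInt_root hθ ψ)

end Summit.BirchSwinnertonDyer.BirchSwinnertonDyer.Rank2Observatory.TwoDescCubic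

end
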